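import Mathlib.Analysis.Asymptotics.Defs
import Mathlib.Analysis.SpecialFunctions.Complex.Circle
import Mathlib.Data.Finsupp.Basic
import Literature.MathematicalPhysics.QuantumLattice.GrassmannIntegral
import HarnessLib

/-!
# Barrier: no ultralocal Ginsparg–Wilson fermions (Horváth 1998; Bietenholz 1999)

Barrier catalogue `Literature/Barriers/QuantumFields/` (D-0021), summit `QuantumFields`
(conjunct `QCD`). Companion to `Literature.Barriers.QuantumFields.NielsenNinomiya`: the
Ginsparg–Wilson relation is the known evasion of the Nielsen–Ninomiya theorem, and this barrier
says that the evasion cannot be realised by a finite-range ("ultralocal") lattice Dirac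
operator.

## The printed result

Horváth 1998 (Phys. Rev. Lett. 81, 4063), Abstract and Theorem: "It is shown that it is
impossible to construct a free theory of fermions on infinite hypercubic Euclidean lattice in
four dimensions that is: (a) ultralocal, (b) respects symmetries of hypercubic lattice,
(c) corresponding kernel satisfies `D γ₅ + γ₅ D = D γ₅ D` (Ginsparg–Wilson relation),
(d) describes single species of massless Dirac fermions in the continuum limit."
Precisely (Definition (Set `𝒰`) and Theorem "Set `𝒰` is empty", pp. 3–4 of the arXiv version
hep-lat/9808002): write the translation-invariant kernel as `D_{m,n} = Σ_a G^a_{m-n} Γ^a` over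
the Clifford basis; (α) ultralocality — the couplings vanish outside a finite hypercube `𝒞_N`,
so the symbol `D(p) = Σ_n D_n e^{ip·n}` is a matrix of trigonometric polynomials; (β) hypercubic
invariance `D(p) = Σ_a G^a(ℋp) H⁻¹ Γ^a H` for reflections of a single axis and exchanges of two
axes, `H` the induced spinor transformation (`H⁻¹ γ_μ H = -γ_μ` resp. `γ_μ` for the reflection
`ℛ_ν`, `μ = ν` resp. `μ ≠ ν`; `γ_ρ ↔ γ_σ` for the exchange `𝒳_{ρσ}`); (γ) the GW relation;
(δ) continuum limit `G^a(p) = i p_μ + O(p²)` if `Γ^a = γ_μ`, `O(p²)` otherwise; (ε) `D(p)`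
invertible unless `p_μ = 0 (mod 2π)` for all `μ`. **Theorem.** No such kernel exists. Closing
remark (arXiv p. 5): "in the proof of the Theorem, condition (ε) was not used at all. In other
words, there are no acceptable ultralocal solutions of (1) with or without doublers. This is not
true if the requirement of hypercubic symmetry is relaxed. In that case, there exist ultralocal
solutions with doublers and it is still an open question whether doubler-free solutions do
exist."
General Ginsparg–Wilson kernels `{D, γ₅} = 2 D R γ₅ D` (equivalently: the chirally
non-symmetric part `R = (D⁻¹)_N` of the massless propagator is local) — the later literature,
re-read for the barrier audit of 2026-08-16. Horváth 1999 (Phys. Rev. D 60, 034510 =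
hep-lat/9901014), Theorem 1 ("weak non-ultralocality"): for every free GW action with the
symmetries of the hypercubic lattice and the one-species continuum limit the infinitesimal
Ginsparg–Wilson–Lüscher transformation `D_C = 2RD` is non-ultralocal, with or without doublers;
Corollary 1: `R` ultralocal and nonzero forces `D` non-ultralocal, whatever the Dirac structure of
`R` (this contains the present theorem); §3.7: with a *non*-ultralocal local kernel an ultralocal
hypercubic GW action exists but is doubled, `D(p) = (Σ_μ sin²p_μ) 1 + i Σ_μ sin p_μ γ_μ`,
`R(p) = 1/(1 + Σ_μ sin²p_μ)`. Horváth–Balwe–Mendris 2001 (Nucl. Phys. B 599, 283 =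
hep-lat/0006027), Theorem 1 ("strong non-ultralocality"): on `ℤ^d`, `d` even, no free kernel with
translation and full hypercubic invariance and the one-species continuum limit is simultaneously
(α) ultralocal, (β) Ginsparg–Wilson in the general sense `(D⁻¹)_N` local, and (γ) free of
doublers; no hermiticity is assumed, and (γ) cannot be dropped (the example above); the proof
restricts to the momentum plane `(q₁, q₂, 0, …, 0)` and turns analyticity of `(D⁻¹)_N` at the
origin into a factorisation property of the polynomial `x²(1-x²)G² + y²(1-y²)G̃²`
(`x = sin(q₁/2)`, `y = sin(q₂/2)`; their Lemmas 3-4 and Corollary 1, an intersection-theory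
lemma) which produces a doubler at the corner `(π, π)`. Bietenholz 1999 (hep-lat/9901005, v3)
claims the same exclusion for all local `R` in every `d ≥ 2` assuming hermiticity, reflection
and axis-exchange invariance; its STEP 1 (`R` ultralocal) is Horváth's Corollary 1, while its
STEP 2 is contested — Horváth 2000 (hep-lat/0003008), items (a)-(d): the ansatz (2) omits the
`γ₁γ₂` Clifford component allowed by the symmetries, and eqs. (18), (22) rest on a non-unique
polynomial decomposition — so the general-`R` statement is credited below to
Horváth–Balwe–Mendris, not to Bietenholz.

## What is vendored

`NoUltralocalGinspargWilson` renders Horváth's Theorem literally for `4 × 4` kernels on `ℤ⁴`: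
ultralocality + translation invariance = a finitely supported coupling
`D : ℤ⁴ →₀ Matrix (Fin 4) (Fin 4) ℂ` (equivalent to (α), Horváth p. 3), with symbol
`latticeSymbol D p = Σ_n e^{ip·n} D n`; (β) is stated with the spinor matrix `H` existentially
quantified together with its defining conjugation rules (they fix `H` up to a scalar, to which
the covariance condition is insensitive); (δ) entrywise as a big-`O` at `p → 0`; following the
closing remark, the no-doubler condition (ε) is *dropped* from the excluded class (the fact is
the stronger printed statement "no acceptable ultralocal solutions with or without doublers"),
and the emptiness of Set `𝒰` itself is the one-line corollary
`NoUltralocalGinspargWilson.setU_empty`; the Euclidean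
`γ`-matrices are the tree's `QLatticeAQFT.euclideanGamma` with `γ₅ = QLatticeAQFT.gammaFive`
(any two irreducible representations of the Clifford algebra are conjugate, so the choice is
immaterial). Named fact (`Prop`); the printed proof reduces to trigonometric polynomials
`Ā(q)² + 2 B̄(q)² = 1` on the diagonal `p = (q, q, 0, 0)` and a lemma on their Fourier support.
The fact is discharged in the tree: `NoUltralocalGinspargWilson_holds`
(`NoUltralocalGinspargWilsonProofs.lean`, lemmas in `NoUltralocalGinspargWilsonLemmas.lean`).

## Barrier audit (2026-08-16): boundary of the excluded class

* Hypothesis (β) is load-bearing. Without hypercubic symmetry the standard GW relation has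
  ultralocal solutions with the one-species expansion `i Σ_μ p_μ γ_μ + O(p²)` at `p = 0`, all of
  them doubled: e.g. the palindromic product `V = E₁E₂E₃F₄E₃E₂E₁`,
  `E_k = exp(-i (p_k/2) γ_k)`, `F₄ = exp(-i p₄ γ₄)`, has integer Fourier frequencies,
  `γ₅ V γ₅ = V⁻¹` (so `D = 1 - V` satisfies (γ) and is `γ₅`-hermitian) and expands to
  `V = c₁c₂c₃c₄ - i(c₂c₃c₄ s₁ γ₁ + c₃c₄ s₂ γ₂ + c₄ s₃ γ₃ + s₄ γ₄)` (`c_μ = cos p_μ`,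
  `s_μ = sin p_μ`), i.e. `A² + Σ_μ b_μ² = 1` telescopically: `8` species, at the corners
  `p_μ ∈ {0, π}` with an even number of `π`'s, net chirality zero; a `15`-site non-hermitian
  variant is `A = cos p₁ - ½ e^{ip₁} Σ_{k ≥ 2} sin²p_k`, `b₁ = sin p₁ + ½ i e^{ip₁} Σ_{k ≥ 2} sin²p_k`,
  `b_k = sin p_k` (`k = 2, 3, 4`), `D = (1 - A) 1 + i Σ_μ b_μ γ_μ`, with `8` species at `p₁ = 0`,
  `p_k ∈ {0, π}` (both numerically checked in the audit folder, GW residual `10⁻¹⁵`).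
* Horváth's open question (doubler-free ultralocal GW kernels with translation invariance only,
  arXiv p. 5; still open in Horváth 2000, §1) appears to have a negative answer for
  `γ₅`-hermitian kernels and `R = 1/2`, in every even dimension and for any flavour multiplicity
  with `Γ₅ = γ₅ ⊗ 1` (audit derivation, not found in print in this form): `H(p) = γ₅(D(p) - 1)` is
  then a hermitian, strictly finite-range Bloch "Hamiltonian" with `H² = 1` (this *is* the GW
  relation), i.e. an exactly flat-band model, whose band bundles are stably trivial — all Chern
  numbers vanish — by the no-go theorem for strictly local flat bands / compactly supported
  Wannier functions (Dubail–Read 2015; Read 2017, §1.3; Chen–Mazaheri–Seidel–Tang 2014 for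
  `d = 2`), whereas the family `γ₅(D(p) - m)` is gapped on the torus for `m ∈ (0, 2)` (GW
  spectrum on `|z - 1| = 1`) and for `m < 0`, trivial as `m → -∞`, and for a doubler-free kernel
  closes its gap only at `(p, m) = (0, 0)`, where it is the five-`Γ` Dirac monopole
  `Σ_μ p_μ (iγ₅γ_μ) - m γ₅ + O(p²)`, forcing Chern number `±1` (`±N_f`) on the `m > 0` side.
  With doublers the monopole charges cancel, as in the example above.
* Euclidean spacetime-lattice actions only. On a spatial lattice with continuous time there are
  *ultralocal* free-fermion Hamiltonians with exact, ultralocally generated, not-on-site chiral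
  symmetries "of Ginsparg–Wilson type": a single Weyl fermion protected by a non-compact `U(1)`
  and a Weyl doublet whose two `U(1)` charges generate the Onsager algebra in `3+1` dimensions
  (Gioia–Thorngren 2026), a quantized ultralocal axial charge for `1+1`-dimensional staggered
  fermions (Chatterjee–Pace–Shao 2025). Neither Horváth's theorem nor its general-`R` form says
  anything about this setting.

## References

[Horvath1998] [Horvath1999] [HorvathBalweMendris2001] [Horvath2000] [Bietenholz1999]
[GinspargWilson1982] [Luscher1998] [Neuberger1998] [HernandezJansenLuscher1999]
[NielsenNinomiya1981c] [Kaplan1992] [Shamir1993] [DubailRead2015] [Read2017] [ChenEtAl2014]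
[GioiaThorngren2026] [ChatterjeePaceShao2025]
-/

noncomputable section

open Complex Asymptotics Filter
open scoped Topology

namespace Literature.Barriers.QuantumFields

open Literature.MathematicalPhysics.QuantumLattice (euclideanGamma gammaFive)

/-- The **symbol** (diagonal Fourier image) `D(p) = Σ_{n ∈ ℤ⁴} e^{i p·n} D_n` of a
translation-invariant, finitely supported (= ultralocal) matrix coupling `n ↦ D_n` on the
hypercubic lattice `ℤ⁴`; a `4 × 4` matrix of trigonometric polynomials in the lattice momenta
`p`. [cite: Horvath1998, eqs. (3)-(4) (arXiv p. 3)] -/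
def latticeSymbol (D : (Fin 4 → ℤ) →₀ Matrix (Fin 4) (Fin 4) ℂ) (p : Fin 4 → ℝ) :
    Matrix (Fin 4) (Fin 4) ℂ :=
  D.sum fun n M => cexp (I * ((∑ μ, p μ * (n μ : ℝ) : ℝ) : ℂ)) • M

/-- Reflection of the `ν`-th momentum axis, `(ℛ_ν p)_μ = -p_μ` if `μ = ν`, else `p_μ`.
[cite: Horvath1998, arXiv p. 3 (hypercubic symmetry)] -/
def reflectAxis (ν : Fin 4) (p : Fin 4 → ℝ) : Fin 4 → ℝ :=
  fun μ => if μ = ν then -p μ else p μ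

/-- Exchange of the momentum axes `ρ` and `σ`, `𝒳_{ρσ} p = p ∘ (ρ σ)`.
[cite: Horvath1998, arXiv p. 3 (hypercubic symmetry)] -/
def swapAxes (ρ σ : Fin 4) (p : Fin 4 → ℝ) : Fin 4 → ℝ :=
  fun μ => p (Equiv.swap ρ σ μ)

/-- Hypothesis (β) of Horváth's Definition (Set `𝒰`): **hypercubic invariance** of the symbol
`Dp`, `D(p) = H⁻¹ D(ℋ p) H` for every single-axis reflection `ℋ = ℛ_ν` and every exchange of
two axes `ℋ = 𝒳_{ρσ}`, where `H` is the induced spinor transformation, characterised (up to an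
irrelevant scalar) by `H⁻¹ γ_μ H = -γ_μ` (`μ = ν`), `= γ_μ` (`μ ≠ ν`) for `ℛ_ν`, and
`H⁻¹ γ_ρ H = γ_σ`, `H⁻¹ γ_σ H = γ_ρ`, `H⁻¹ γ_μ H = γ_μ` otherwise for `𝒳_{ρσ}`.
[cite: Horvath1998, arXiv p. 3, eq. (5) and the two displayed transformation rules] -/
def IsHypercubicInvariantSymbol (Dp : (Fin 4 → ℝ) → Matrix (Fin 4) (Fin 4) ℂ) : Prop :=
  (∀ ν : Fin 4, ∃ H : Matrix (Fin 4) (Fin 4) ℂ, IsUnit H.det ∧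
      (∀ μ : Fin 4, H⁻¹ * euclideanGamma μ * H =
        if μ = ν then -euclideanGamma μ else euclideanGamma μ) ∧
      ∀ p, Dp p = H⁻¹ * Dp (reflectAxis ν p) * H) ∧
  (∀ ρ σ : Fin 4, ρ ≠ σ → ∃ H : Matrix (Fin 4) (Fin 4) ℂ, IsUnit H.det ∧
      (∀ μ : Fin 4, H⁻¹ * euclideanGamma μ * H = euclideanGamma (Equiv.swap ρ σ μ)) ∧
      ∀ p, Dp p = H⁻¹ * Dp (swapAxes ρ σ p) * H)

/-- **No ultralocal Ginsparg–Wilson fermions (Horváth 1998, Theorem "Set `𝒰` is empty" with its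
closing remark).** There is no finitely supported (ultralocal, translation-invariant) coupling
`D : ℤ⁴ →₀ Mat₄(ℂ)` of free `4`-component fermions on the infinite hypercubic lattice `ℤ⁴` whose
symbol `D(p) = Σ_n e^{ip·n} D_n` (β) is hypercubic invariant, (γ) satisfies the Ginsparg–Wilson
relation `D(p) γ₅ + γ₅ D(p) = D(p) γ₅ D(p)`, and (δ) has the continuum limit of a single massless
Dirac fermion at the origin, `D(p) = i Σ_μ p_μ γ_μ + O(p²)` as `p → 0` (entrywise) — with or
without doublers: "in the proof of the Theorem, condition (ε) was not used at all. In other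
words, there are no acceptable ultralocal solutions of (1) with or without doublers" (arXiv p. 5).
The extension to general local Ginsparg–Wilson kernels `R = (D⁻¹)_N` — for doubler-free kernels
with translation and full hypercubic invariance in every even dimension, no hermiticity assumed —
is Horváth–Balwe–Mendris 2001, Theorem 1; for ultralocal `R` already Horváth 1999, Corollary 1;
Bietenholz's 1999 claim of the same exclusion is contested (Horváth 2000) and is not relied upon
here (all docstring only; see the module docstring, "Barrier audit", for the boundary of the class).
[cite: Horvath1998, Definition (Set 𝒰) (α)-(δ), Theorem, and closing remark, arXiv pp. 3-5]
[cite: HorvathBalweMendris2001, Theorem 1 and §5] [cite: Horvath1999, Theorem 1, Corollary 1, §3.7]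

BARRIER
technique_class: ultralocal-lattice-dirac-operator, finite-range-lattice-fermions, ginsparg-wilson-fermions, exact-chiral-symmetry, chiral-lattice-fermions
blocks: realising exact Ginsparg–Wilson–Lüscher lattice chiral symmetry for the quark sector of `QCD` — the known evasion of `Literature.Barriers.QuantumFields.NielsenNinomiya` — by a hypercubic-symmetric, translation-invariant, *ultralocal* Euclidean lattice Dirac operator with the one-species continuum limit at `p = 0`: for the standard kernel `R = 1/2` no such free kernel exists with or without doublers (this fact, proved in-tree), and for a general local kernel `R = (D⁻¹)_N` none exists that is free of doublers [cite: HorvathBalweMendris2001, Theorem 1] (for ultralocal `R` again regardless of doublers [cite: Horvath1999, Corollary 1]); since a gauge-covariant ultralocal operator restricts to a free one at `U = 1`, every hypercubic-symmetric GW operator with the correct continuum limit (overlap, perfect actions) has couplings of unbounded range; the printed costs are that "this complicates the perturbation theory with such actions considerably", "one looses the obvious numerical advantages steming from sparcity of the conventional operators such as Wilson-Dirac operator", and "locality (exponential decay of interaction at large distances) … is usually not obvious in the presence of the gauge fields if the action is not ultralocal" [cite: Horvath1998, arXiv p. 2] [cite: Horvath1999, §3.7] [cite: Bietenholz1999, p.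 3 ("we cannot simulate fermions obeying the GWR as formulated in the infinite volume")]
because: hypercubic symmetry reduces the symbol on the diagonal `p = (q,q,0,0)` to `(1-Ā(q))1 + iB̄(q)(γ₁+γ₂)`; the GW relation becomes `Ā² + 2B̄² = 1` and the continuum limit forces `Ā = 1 + O(q²)`, `B̄ = q + O(q²)`; for trigonometric polynomials (ultralocality) such an identity forces a single Fourier mode `Ā = cos Kq`, `B̄ = sin(Kq)/K`, whence `2/K² = 1`, impossible for an integer `K`; the no-doubler condition is never used [cite: Horvath1998, proof of the Theorem, Lemma, and closing remark, arXiv pp. 4-5]; for a general local kernel the same diagonal restriction shows that the GWL transformation `D_C = 2RD` is never ultralocal [cite: Horvath1999, Theorem 1], and for ultralocal `D` the restriction to the plane `(q₁, q₂, 0, …, 0)` leaves `D̄ = Ā1 + iB̄_μγ_μ + C̄γ₁γ₂`, polynomial in `x = sin(q₁/2)`, `y = sin(q₂/2)` up to explicit square roots; analyticity of `(D̄⁻¹)_N = (Ā - C̄γ₁γ₂)/Q̄`, `Q̄ = Ā² + B̄_μB̄_μ + C̄²`, at the origin forces a common polynomial factor of `Ā`, `xyC̄`, `Q̄` and hence of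 `B̄_μB̄_μ = x²(1-x²)G² + y²(1-y²)G̃²` vanishing at the origin, and every such factor has two further zeros on `{-1, 0, 1}²`, i.e. `Q̄` vanishes at a corner `(π, π)` of the restricted Brillouin zone: a doubler [cite: HorvathBalweMendris2001, Lemmas 1-4, Corollary 1, §5 and Proposition 4]
evasions_known: settle for locality with exponentially decaying couplings — Neuberger's overlap operator satisfies the GW relation [cite: Neuberger1998] and is exponentially local for sufficiently smooth gauge fields (plaquettes near `1`) [cite: HernandezJansenLuscher1999], which is what Lüscher's exact chiral symmetry needs [cite: Luscher1998]; in finite volume the GWR can hold with couplings across the whole volume, and truncated perfect / short-range approximate GW operators can be fed into the overlap formula [cite: Bietenholz1999, p. 3]; domain-wall fermions trade ultralocality in four dimensions for a fifth dimension of extent `L_s` [cite: Kaplan1992] [cite: Shamir1993]; keep hypercubic symmetry and ultralocality but accept doublers with a momentum-dependent local kernel — `D(p) = (Σ_μ sin²p_μ)1 + iΣ_μ sin p_μ γ_μ`, `R = 1/(1 + Σ_μ sin²p_μ)`, `2^d` species [cite: Horvath1999, §3.7, the display after Corollary 1]; relax hypercubic symmetry — then "there exist ultralocal solutions with doublers and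 it is still an open question whether doubler-free solutions do exist" [cite: Horvath1998, closing remark, arXiv p. 5] [cite: Horvath2000, §1]: explicit doubled ones are the telescoping kernels of the module docstring ("Barrier audit"), while for `γ₅`-hermitian kernels doubler-free ones are excluded in every even dimension by the flat-band obstruction recorded there (`H = γ₅(D - 1)` is a strictly local flat-band Hamiltonian, hence carries no Chern number [cite: DubailRead2015, no-go theorem] [cite: Read2017, §1.3] [cite: ChenEtAl2014], against the `±1` forced by a single Dirac point — audit derivation), so this evasion only ever yields doubled kernels; leave the Euclidean action formalism — Hamiltonian lattice fermions in continuous time admit ultralocal Hamiltonians with exact, ultralocally generated, not-on-site chiral symmetries of Ginsparg–Wilson type (single Weyl fermion with a non-compact `U(1)`; Weyl doublet with two `U(1)` charges generating the Onsager algebra, `3+1`D) [cite: GioiaThorngren2026, Abstract and §1] and a quantized ultralocal axial charge for staggered fermions in `1+1`D [cite: ChatterjeePaceShao2025], outside the reach of the Euclidean theorems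
scope_caveats: the formal fact covers free (no gauge field) `4`-component, single-flavour kernels on `ℤ⁴` with the standard GW kernel `R = 1/2` and full hypercubic (reflection + axis-exchange) invariance in the spinor-conjugation form (β), and is proved in-tree (`NoUltralocalGinspargWilson_holds`); flavour-mixing kernels on which the point group acts through flavour (staggered type) are outside Horváth's `16`-element Clifford decomposition and outside the formal fact (for `γ₅ ⊗ 1`-hermitian kernels with `R = 1/2` the flat-band obstruction of the module docstring still excludes a doubler-free spectrum); the general-`R` exclusion [cite: HorvathBalweMendris2001, Theorem 1] needs the doubler-free condition and full hypercubic symmetry and is docstring-only, Bietenholz's proof for general local `R` [cite: Bietenholz1999, pp. 2-4] is contested [cite: Horvath2000, items (a)-(d)] and not relied upon; with translation invariance ONLY: doubled ultralocal GW kernels exist (module docstring), doubler-free ones are excluded for `γ₅`-hermitian `R = 1/2` kernels by the flat-band obstruction (audit derivation, module docstring) and the general non-hermitian / general-`R` translation-only case is open in print [cite: Horvath2000, §1]; Euclidean spacetime-lattice kernels only — continuous-time Hamiltonian lattice fermions with ultralocal exact chiral symmetries [cite: GioiaThorngren2026] are not in the class; exponentially local (non-ultralocal) GW operators and non-GW actions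 (Wilson, staggered; the tree's `Literature.MathematicalPhysics.QuantumFieldTheory.QCD` uses Wilson fermions) are not in the technique class
status: established [cite: Horvath1998, Theorem] [cite: HorvathBalweMendris2001, Theorem 1]; proved in-tree for `R = 1/2` (`NoUltralocalGinspargWilson_holds`); the attribution to [cite: Bietenholz1999] is disputed [cite: Horvath2000]
-/
def NoUltralocalGinspargWilson : Prop :=
  ¬ ∃ D : (Fin 4 → ℤ) →₀ Matrix (Fin 4) (Fin 4) ℂ,
      -- (β) hypercubic invariance of the symbol
      IsHypercubicInvariantSymbol (latticeSymbol D) ∧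
      -- (γ) the Ginsparg–Wilson relation
      (∀ p, latticeSymbol D p * gammaFive + gammaFive * latticeSymbol D p =
        latticeSymbol D p * gammaFive * latticeSymbol D p) ∧
      -- (δ) continuum limit: `D(p) = i Σ_μ p_μ γ_μ + O(p²)` entrywise at `p → 0`
      (∀ i j : Fin 4,
        (fun p : Fin 4 → ℝ =>
            (latticeSymbol D p - ∑ μ, (I * (p μ : ℂ)) • euclideanGamma μ) i j) =O[𝓝 0]
          fun p => ‖p‖ ^ 2)

/-- **Horváth's Theorem verbatim: Set `𝒰` is empty** — the version with the no-doubler condition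
(ε) "`D(p)` is invertible unless `p_μ = 0 (mod 2π)` for all `μ`" as a further hypothesis on the
excluded kernel; a one-line consequence of `NoUltralocalGinspargWilson` (which omits (ε), as the
printed proof does). [cite: Horvath1998, Definition (Set 𝒰) (α)-(ε) and Theorem, arXiv pp. 3-4] -/
theorem NoUltralocalGinspargWilson.setU_empty (h : NoUltralocalGinspargWilson) :
    ¬ ∃ D : (Fin 4 → ℤ) →₀ Matrix (Fin 4) (Fin 4) ℂ,
      IsHypercubicInvariantSymbol (latticeSymbol D) ∧
      (∀ p, latticeSymbol D p * gammaFive + gammaFive * latticeSymbol D p =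
        latticeSymbol D p * gammaFive * latticeSymbol D p) ∧
      (∀ i j : Fin 4,
        (fun p : Fin 4 → ℝ =>
            (latticeSymbol D p - ∑ μ, (I * (p μ : ℂ)) • euclideanGamma μ) i j) =O[𝓝 0]
          fun p => ‖p‖ ^ 2) ∧
      -- (ε) no doublers: `D(p)` invertible unless `p ∈ (2πℤ)⁴`
      (∀ p : Fin 4 → ℝ, (¬ ∀ μ, ∃ k : ℤ, p μ = 2 * Real.pi * k) →
        IsUnit (latticeSymbol D p).det) :=
  fun ⟨D, hβ, hγ, hδ, _⟩ => h ⟨D, hβ, hγ, hδ⟩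

end Literature.Barriers.QuantumFields
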